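import Summits.CriticalPhenomena.SAWScalingLimit.Theorems.SAWLoopFugacityFlowAvoidanceLimitFullBox
import Literature.Probability.LatticeModels.GermRegionLattice
import Literature.Probability.LatticeModels.AnnulusManeuver
import HarnessLib

/-!
# The clean Whitney hub box about a macroscopically interior site

Sub-problem `CriticalPhenomena/SAWScalingLimit`, crux `AvoidanceLimit`, line `symplectic-fermion-anchor` (lead c7), stub
`stub_germTwoSided`: lattice packaging of the hub site delivered by `germHub_of_threeScale` (a site `z` of `Θ'` with
`infDist(δz, ∂D) ≥ ρ`). If `z ∈ meshDomain D δ` has `infDist (δz) ∂D ≥ 400 δ` there is a box scale `k ≥ 1` with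
`100 k δ ≤ infDist(δz, ∂D) ≤ 800 k δ` (Whitney: the box radius is comparable to the distance to the boundary) such that the big
frame `mW z (2k) = {|· − z|∞ ≤ 96 k}` consists of mesh-domain sites all of whose four lattice edges are edges of
`Ω^δ = discreteDomainGraph D.carrier δ`, and every such site lies within `infDist(δz, ∂D) − 2δ` of `δz` (so it belongs to
every open subset of `D` containing the ball `B(δz, infDist(δz,∂D))`, e.g. to the germ region). Proof: `k := ⌊infDist/(400δ)⌋₊`,
`discreteDomainGraph_full_on_box` on `sqBox z (96 k) ⊇ mW z (2k)`, the closed `δ`-balls about the sites of `sqBox z (96 k + 1)`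
lying in the open ball `B(δz, infDist(δz,∂D)) ⊆ D`.
[folklore]
-/

noncomputable section

open scoped Classical Topology
open Set Metric Filter
open Literature.Probability.LatticeModels
open Literature.Probability.RandomPlanarGeometry (JordanDomain)

namespace Summit.CriticalPhenomena.SAWScalingLimit.Theorems.AvoidanceLimit.Anchor

/-- For `x` in an open set `Ω`, the open ball about `x` of radius `dist(x, ∂Ω)` lies in `Ω`: it is
connected, meets `Ω` and misses `∂Ω`. [folklore] -/
theorem ball_infDist_frontier_subset_of_isOpen {Ω : Set ℂ} (hΩ : IsOpen Ω) {x : ℂ} (hx : x ∈ Ω) :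
    Metric.ball x (Metric.infDist x (frontier Ω)) ⊆ Ω := by
  rcases le_or_gt (Metric.infDist x (frontier Ω)) 0 with h0 | h0
  · rw [Metric.ball_eq_empty.2 h0]
    exact Set.empty_subset _
  refine (convex_ball x _).isPreconnected.subset_of_closure_inter_subset hΩ
    ⟨x, Metric.mem_ball_self h0, hx⟩ ?_
  rintro y ⟨hyc, hyb⟩
  have hyf : y ∉ frontier Ω := Metric.ball_infDist_subset_compl hyb
  have hy : y ∈ closure Ω \ frontier Ω := ⟨hyc, hyf⟩
  rwa [closure_sdiff_frontier, hΩ.interior_eq] at hy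

/-- Mesh points of two sites at sup-distance `≤ M` on the lattice are within `2 M δ` of each other
(`ℓ¹` bound on the Euclidean norm). [folklore] -/
theorem dist_meshPoint_le_of_mem_sqBox {δ : ℝ} (hδ : 0 ≤ δ) {x z : Site 2} {M : ℤ}
    (h : x ∈ WeakBeurling.sqBox z M) :
    dist (meshPoint δ x) (meshPoint δ z) ≤ δ * (2 * (M : ℝ)) := by
  rw [WeakBeurling.mem_sqBox] at h
  obtain ⟨h0, h1⟩ := h
  have h0' : |((x 0 : ℤ) : ℝ) - ((z 0 : ℤ) : ℝ)| ≤ (M : ℝ) := by exact_mod_cast h0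
  have h1' : |((x 1 : ℤ) : ℝ) - ((z 1 : ℤ) : ℝ)| ≤ (M : ℝ) := by exact_mod_cast h1
  rw [Complex.dist_eq]
  refine (Complex.norm_le_abs_re_add_abs_im _).trans ?_
  have hre : (meshPoint δ x - meshPoint δ z).re = δ * (((x 0 : ℤ) : ℝ) - ((z 0 : ℤ) : ℝ)) := by
    simp only [Complex.sub_re, meshPoint_re]; ring
  have him : (meshPoint δ x - meshPoint δ z).im = δ * (((x 1 : ℤ) : ℝ) - ((z 1 : ℤ) : ℝ)) := by
    simp only [Complex.sub_im, meshPoint_im]; ring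
  rw [hre, him, abs_mul, abs_mul, abs_of_nonneg hδ]
  have e0 := mul_le_mul_of_nonneg_left h0' hδ
  have e1 := mul_le_mul_of_nonneg_left h1' hδ
  linarith

/-- **Clean Whitney hub box.** See the module docstring. [folklore] -/
theorem exists_clean_hubBox :
    ∀ (D : JordanDomain) (δ : ℝ), 0 < δ → ∀ z ∈ meshDomain D.carrier δ,
      400 * δ ≤ Metric.infDist (meshPoint δ z) (frontier D.carrier) →
      ∃ k : ℕ, 0 < k ∧ 100 * (k : ℝ) * δ ≤ Metric.infDist (meshPoint δ z) (frontier D.carrier) ∧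
        Metric.infDist (meshPoint δ z) (frontier D.carrier) ≤ 800 * (k : ℝ) * δ ∧
        ∀ w ∈ mW z (2 * k), w ∈ meshDomain D.carrier δ ∧
          dist (meshPoint δ w) (meshPoint δ z) ≤ Metric.infDist (meshPoint δ z) (frontier D.carrier) - 2 * δ ∧
          ∀ e : SRW.Dir 2, (discreteDomainGraph D.carrier δ).Adj w (w + SRW.stepVec e) := by
  intro D δ hδ z hz hdist
  set d := Metric.infDist (meshPoint δ z) (frontier D.carrier) with hd
  have h400 : (0 : ℝ) < 400 * δ := by positivity
  -- the Whitney box parameter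
  set k : ℕ := ⌊d / (400 * δ)⌋₊ with hk
  have hk1 : 1 ≤ k := by
    rw [hk, Nat.one_le_floor_iff, le_div_iff₀ h400]
    linarith
  have hd0 : 0 ≤ d := Metric.infDist_nonneg
  have hkle : (k : ℝ) ≤ d / (400 * δ) := Nat.floor_le (div_nonneg hd0 h400.le)
  have hklt : d / (400 * δ) < k + 1 := Nat.lt_floor_add_one _
  have hkd : 400 * (k : ℝ) * δ ≤ d := by
    have h := (le_div_iff₀ h400).1 hkle
    linarith
  have hdk : d < 400 * ((k : ℝ) + 1) * δ := by
    have h := (div_lt_iff₀ h400).1 hklt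
    linarith
  have hk1' : (1 : ℝ) ≤ k := by exact_mod_cast hk1
  have hkδ : δ ≤ (k : ℝ) * δ := le_mul_of_one_le_left hδ.le hk1'
  refine ⟨k, hk1, by linarith, by linarith, ?_⟩
  -- the open ball of radius `d` about `δ z` lies in `D`
  have hzD : meshPoint δ z ∈ D.carrier := meshDomain_subset_meshVertices _ _ hz
  have hballD : Metric.ball (meshPoint δ z) d ⊆ D.carrier :=
    ball_infDist_frontier_subset_of_isOpen D.isOpen hzD
  -- the closed `δ`-balls about the mesh points of the sites of the bigger box lie in `D`
  have hball : ∀ x ∈ WeakBeurling.sqBox z (((96 * k : ℕ) : ℤ) + 1),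
      Metric.closedBall (meshPoint δ x) δ ⊆ D.carrier := by
    intro x hx p hp
    apply hballD
    rw [Metric.mem_ball]
    have hxz := dist_meshPoint_le_of_mem_sqBox hδ.le hx
    push_cast at hxz
    rw [Metric.mem_closedBall] at hp
    calc dist p (meshPoint δ z) ≤ dist p (meshPoint δ x) + dist (meshPoint δ x) (meshPoint δ z) :=
          dist_triangle _ _ _
      _ ≤ δ + δ * (2 * (96 * (k : ℝ) + 1)) := add_le_add hp hxz
      _ < d := by linarith
  intro w hw
  -- the frame `mW z (2k)` is the lattice box `sqBox z (96 k)`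
  have hwbox : w ∈ WeakBeurling.sqBox z ((96 * k : ℕ) : ℤ) := by
    simp only [mW, Set.mem_setOf_eq] at hw
    rw [WeakBeurling.mem_sqBox]
    push_cast at hw ⊢
    constructor <;> linarith [hw.1, hw.2]
  obtain ⟨hwfin, hnb⟩ :=
    discreteDomainGraph_full_on_box D.carrier D.isBounded δ hδ z (96 * k) hz hball w hwbox
  have hwdom : w ∈ meshDomain D.carrier δ := by
    rw [← coe_meshDomainFinset D.isBounded hδ]
    exact hwfin
  refine ⟨hwdom, ?_, fun e => (hnb _ (zdGraph_adj_add_stepVec w e)).2⟩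
  have hwz := dist_meshPoint_le_of_mem_sqBox hδ.le hwbox
  push_cast at hwz
  linarith

end Summit.CriticalPhenomena.SAWScalingLimit.Theorems.AvoidanceLimit.Anchor

end
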